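import Literature.Computability.Complexity.DiscreteTomography
import HarnessLib

/-!
# Fischer–Ikenmeyer 2020, Lemma 8: the symmetrization `γ` of 2D-X-RAY instances (combinatorics)

Fischer–Ikenmeyer, *The computational complexity of plethysm coefficients*, Comput. Complexity 29
(2020), Lemma 8 ("There exist parsimonious polynomial-time reductions from 2D-X-RAY to
SYMMETRIC-2D-X-RAY and to SKEW-SYMMETRIC-2D-X-RAY"), printed proof (§6, p. 13 of the held copy
`arxiv-2002.00788`): an instance `(μ', ν', ρ') ∈ (ℕ^{[0,r']})³` of 2D-X-RAY (Problem 5) is sent to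
ONE composition `λ` obtained by writing `ρ'`, `ν'`, `μ'` into three windows `R`, `N`, `M` of
`[0, r]` separated by zeros, and the translation `γ(x, y, z) = (x + min M, y + min N, z)` is a
bijection from the point sets `P ⊆ G_{r'}` with `(X, Y, Z)`-marginals `(μ', ν', ρ')` onto the point
sets `P ⊆ G_r ∩ C̄` (equally `G_r ∩ C`) with sum-marginal `λ`: well-definedness and injectivity are
immediate, and surjectivity holds because every coordinate of a solution point lies in
`M ∪ N ∪ R` (`λ` vanishes elsewhere) while "two coordinates in the same window" contradicts
`x + y + z = r`, so each solution point lies in `M × N × R` and `(x - min M, y - min N, z)` is a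
preimage.

This file proves exactly this, for the tree's renderings `Tomography.twoDXRaySet`,
`Tomography.symTwoDXRaySet`, `Tomography.skewSymTwoDXRaySet` (`DiscreteTomography.lean`):

* `Symmetrization.lam μ ν ρ` — the composition `λ`; `listFn_lam` (its entries),
  `cases_of_listFn_lam_ne_zero` (its support is `R ∪ N ∪ M`);
* `Symmetrization.shift s` / `unshift s` — `γ` and its inverse; `forward` (`γ` maps solutions to
  solutions in the OPEN cone), `box_of_solution` (every solution point of the symmetric instance,
  closed cone, lies in `M × N × R`), `backward` (the preimage is a solution);
* `Symmetrization.mem_twoDXRaySet_iff_sym`, `mem_twoDXRaySet_iff_skewSym` — **the decision form of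
  Lemma 8 at the level of instances**: for `|μ| = |ν| = |ρ|`,
  `(μ, ν, ρ) ∈ twoDXRaySet ↔ λ ∈ symTwoDXRaySet ↔ λ ∈ skewSymTwoDXRaySet`.

The polynomial-time map on codes and the discharge `FischerIkenmeyer2020_lemma8_holds` are in
`DiscreteTomographySymmetrizationFP.lean`.

Design note (constants). The printed choice is `r := 13 r'`, windows `R = [0, r']`,
`N = [3r', 4r']`, `M = [9r', 10r']` (the printed `M := [8r', 9r']` is a typo), zero blocks of
lengths `2r' - 1`, `5r' - 1`, `3r'`, and `γ(x, y, z) = (x + 9r', y + 3r', z)`; it presupposes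
`r' ≥ 1` (at `r' = 0` the padding lengths are negative and the three windows coincide). We use the
same architecture with constants that need no natural subtraction and cover every `r' ≥ 0`
uniformly: with `s := r' + 1 = |μ'| = |ν'| = |ρ'|`,
`λ := (ρ', 0^s, ν', 0^{3s}, μ', 0^{2s}) ∈ ℕ^{[0, 9s-1]}` (so `r = 9s - 1`, `R = [0, s)`,
`N = [2s, 3s)`, `M = [6s, 7s)`) and `γ(x, y, z) = (x + 6s, y + 2s, z)`. The printed case analysis
goes through verbatim: two coordinates in `R` force the third `≥ 7s + 1`, two in `N` force the third
into `[3s + 1, 5s - 1]`, two in `M` force `x + y + z ≥ 12s > r`; all three are impossible. Since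
`x, y, z ≤ r' < s` on `G_{r'}`, the image of `γ` lies in the open cone `x + 6s > y + 2s > z`, so one
`λ` serves both target problems (as printed: "without any changes the whole proof also works for the
open cone"). Only the decision form is needed downstream; the bijection is nevertheless what is
proved (`forward`/`backward` are mutually inverse translations).

## References

* [FischerIkenmeyer2020] N. Fischer, C. Ikenmeyer, *The computational complexity of plethysm
  coefficients*, Comput. Complexity 29 (2020) 8, arXiv:2002.00788 (held), §6, Problems 5 and 7,
  Lemma 8 and its proof, Fig. 3 (symmetrization).
-/

namespace Literature.Computability.Complexity

namespace Tomography

namespace Symmetrization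

/-! ### Compositions as finitely supported functions -/

/-- Entries of a concatenation. [folklore] -/
theorem listFn_append (l₁ l₂ : List ℕ) (i : ℕ) :
    listFn (l₁ ++ l₂) i = if i < l₁.length then listFn l₁ i else listFn l₂ (i - l₁.length) := by
  simp only [listFn, List.getD_eq_getElem?_getD, List.getElem?_append]
  split_ifs <;> rfl

/-- Entries of a block of zeros. [folklore] -/
theorem listFn_replicate (k i : ℕ) : listFn (List.replicate k 0) i = 0 := by
  simp only [listFn, List.getD_eq_getElem?_getD, List.getElem?_replicate]
  split_ifs <;> rfl

/-- A nonzero entry lies inside the list. [folklore] -/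
theorem lt_length_of_listFn_ne_zero {l : List ℕ} {i : ℕ} (h : listFn l i ≠ 0) : i < l.length := by
  by_contra hi
  exact h (listFn_of_le (not_lt.1 hi))

/-! ### The symmetric instance `λ` -/

/-- **The SYMMETRIC-2D-X-RAY instance of a 2D-X-RAY instance** `(μ, ν, ρ)` with `|μ| = s`:
`λ := (ρ, 0^s, ν, 0^{3s}, μ, 0^{2s}) ∈ ℕ^{[0, 9s-1]}` — `ρ` in the window `R = [0, s)`, `ν` in
`N = [2s, 3s)`, `μ` in `M = [6s, 7s)`, zeros elsewhere (the printed `λ` with the constants of the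
module docstring). [cite: FischerIkenmeyer2020, Lemma 8 (proof)] -/
def lam (μ ν ρ : List ℕ) : List ℕ :=
  ρ ++ (List.replicate μ.length 0 ++ (ν ++ (List.replicate (3 * μ.length) 0 ++
    (μ ++ List.replicate (2 * μ.length) 0))))

variable {μ ν ρ : List ℕ}

/-- `|λ| = 9s` (i.e. `λ ∈ ℕ^{[0, r]}` with `r = 9s - 1`). [cite: FischerIkenmeyer2020, Lemma 8 (proof)] -/
theorem length_lam (hν : ν.length = μ.length) (hρ : ρ.length = μ.length) :
    (lam μ ν ρ).length = 9 * μ.length := by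
  simp only [lam, List.length_append, List.length_replicate, hν, hρ]; ring

/-- **The entries of `λ`**: `λ_i = ρ_i + ν_{i - 2s} [2s ≤ i] + μ_{i - 6s} [6s ≤ i]` (all lists read
as finitely supported functions). [cite: FischerIkenmeyer2020, Lemma 8 (proof)] -/
theorem listFn_lam (hν : ν.length = μ.length) (hρ : ρ.length = μ.length) (i : ℕ) :
    listFn (lam μ ν ρ) i = listFn ρ i +
      (if 2 * μ.length ≤ i then listFn ν (i - 2 * μ.length) else 0) +
      (if 6 * μ.length ≤ i then listFn μ (i - 6 * μ.length) else 0) := by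
  have eρ : ∀ j, μ.length ≤ j → listFn ρ j = 0 := fun j hj => listFn_of_le (by omega)
  have eν : ∀ j, μ.length ≤ j → listFn ν j = 0 := fun j hj => listFn_of_le (by omega)
  have eμ : ∀ j, μ.length ≤ j → listFn μ j = 0 := fun j hj => listFn_of_le hj
  simp only [lam, listFn_append, listFn_replicate, List.length_replicate, hν, hρ]
  by_cases h1 : i < μ.length
  · rw [if_pos h1, if_neg (by omega), if_neg (by omega), Nat.add_zero]
  rw [if_neg h1, eρ i (by omega), Nat.zero_add]
  by_cases h2 : i - μ.length < μ.length
  · rw [if_pos h2, if_neg (by omega), if_neg (by omega)]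
  rw [if_neg h2]
  by_cases h3 : i - μ.length - μ.length < μ.length
  · rw [if_pos h3, if_pos (by omega), if_neg (by omega), Nat.add_zero,
      show i - μ.length - μ.length = i - 2 * μ.length by omega]
  rw [if_neg h3, if_pos (show 2 * μ.length ≤ i by omega), eν _ (by omega), Nat.zero_add]
  by_cases h4 : i - μ.length - μ.length - μ.length < 3 * μ.length
  · rw [if_pos h4, if_neg (by omega)]
  rw [if_neg h4]
  by_cases h5 : i - μ.length - μ.length - μ.length - 3 * μ.length < μ.length
  · rw [if_pos h5, if_pos (by omega),
      show i - μ.length - μ.length - μ.length - 3 * μ.length = i - 6 * μ.length by omega]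
  rw [if_neg h5, if_pos (show 6 * μ.length ≤ i by omega), eμ _ (by omega)]

/-- **`λ` vanishes outside `R ∪ N ∪ M`** ("since `λ_i = 0` for all `i ∉ M ∪ N ∪ R`, it follows that
`x`, `y` and `z` are indeed contained in `M ∪ N ∪ R`"). [cite: FischerIkenmeyer2020, Lemma 8 (proof)] -/
theorem cases_of_listFn_lam_ne_zero (hν : ν.length = μ.length) (hρ : ρ.length = μ.length) {c : ℕ}
    (h : listFn (lam μ ν ρ) c ≠ 0) :
    c < μ.length ∨ (2 * μ.length ≤ c ∧ c < 3 * μ.length) ∨ (6 * μ.length ≤ c ∧ c < 7 * μ.length) := by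
  rw [listFn_lam hν hρ] at h
  by_cases h1 : listFn ρ c ≠ 0
  · exact Or.inl (hρ ▸ lt_length_of_listFn_ne_zero h1)
  by_cases h2 : 2 * μ.length ≤ c ∧ listFn ν (c - 2 * μ.length) ≠ 0
  · exact Or.inr (Or.inl ⟨h2.1, by have := lt_length_of_listFn_ne_zero h2.2; omega⟩)
  by_cases h3 : 6 * μ.length ≤ c ∧ listFn μ (c - 6 * μ.length) ≠ 0
  · exact Or.inr (Or.inr ⟨h3.1, by have := lt_length_of_listFn_ne_zero h3.2; omega⟩)
  exfalso; apply h
  push Not at h1 h2 h3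
  rw [h1, Nat.zero_add]
  split_ifs with ha hb hb
  · rw [h2 ha, h3 hb]
  · rw [h2 ha]
  · rw [h3 hb]
  · rfl

/-! ### The translation `γ` and its inverse -/

/-- **The map `γ`** of the printed proof (with the constants of the module docstring):
`γ(x, y, z) = (x + 6s, y + 2s, z)`. [cite: FischerIkenmeyer2020, Lemma 8 (proof)] -/
def shift (s : ℕ) (p : Point) : Point := (p.1 + 6 * s, p.2.1 + 2 * s, p.2.2)

/-- The explicit preimage `(x - 6s, y - 2s, z)` of the surjectivity argument (natural subtraction;
only applied to points of `M × N × R`, `box_of_solution`). [cite: FischerIkenmeyer2020, Lemma 8 (proof)] -/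
def unshift (s : ℕ) (p : Point) : Point := (p.1 - 6 * s, p.2.1 - 2 * s, p.2.2)

/-- "The injectivity of `γ` is obvious." [cite: FischerIkenmeyer2020, Lemma 8 (proof)] -/
theorem shift_injective (s : ℕ) : Function.Injective (shift s) := by
  rintro ⟨x, y, z⟩ ⟨x', y', z'⟩ h
  simp only [shift, Prod.mk.injEq] at h
  simp only [Prod.mk.injEq]
  omega

/-! ### Marginals of translated point sets -/

/-- `X`-marginal of an injective image: count the fibre upstairs. [folklore] -/
theorem xMarginal_image {f : Point → Point} {Q : Finset Point} (hf : Set.InjOn f Q) (i : ℕ) :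
    xMarginal (Q.image f) i = (Q.filter fun q => (f q).1 = i).card := by
  unfold xMarginal
  rw [Finset.filter_image, Finset.card_image_of_injOn (hf.mono fun q hq => Finset.mem_of_mem_filter q hq)]

/-- `Y`-marginal of an injective image. [folklore] -/
theorem yMarginal_image {f : Point → Point} {Q : Finset Point} (hf : Set.InjOn f Q) (i : ℕ) :
    yMarginal (Q.image f) i = (Q.filter fun q => (f q).2.1 = i).card := by
  unfold yMarginal
  rw [Finset.filter_image, Finset.card_image_of_injOn (hf.mono fun q hq => Finset.mem_of_mem_filter q hq)]

/-- `Z`-marginal of an injective image. [folklore] -/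
theorem zMarginal_image {f : Point → Point} {Q : Finset Point} (hf : Set.InjOn f Q) (i : ℕ) :
    zMarginal (Q.image f) i = (Q.filter fun q => (f q).2.2 = i).card := by
  unfold zMarginal
  rw [Finset.filter_image, Finset.card_image_of_injOn (hf.mono fun q hq => Finset.mem_of_mem_filter q hq)]

/-- An `X`-marginal at a value no point attains is `0`. [folklore] -/
theorem xMarginal_eq_zero {Q : Finset Point} {j : ℕ} (h : ∀ q ∈ Q, q.1 ≠ j) : xMarginal Q j = 0 :=
  Finset.card_eq_zero.2 (Finset.filter_eq_empty_iff.2 fun q hq => h q hq)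

/-- A `Y`-marginal at a value no point attains is `0`. [folklore] -/
theorem yMarginal_eq_zero {Q : Finset Point} {j : ℕ} (h : ∀ q ∈ Q, q.2.1 ≠ j) : yMarginal Q j = 0 :=
  Finset.card_eq_zero.2 (Finset.filter_eq_empty_iff.2 fun q hq => h q hq)

/-- A `Z`-marginal at a value no point attains is `0`. [folklore] -/
theorem zMarginal_eq_zero {Q : Finset Point} {j : ℕ} (h : ∀ q ∈ Q, q.2.2 ≠ j) : zMarginal Q j = 0 :=
  Finset.card_eq_zero.2 (Finset.filter_eq_empty_iff.2 fun q hq => h q hq)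

/-! ### `γ` is well defined: solutions go to solutions, in the open cone -/

/-- **Well-definedness of `γ`**: if `P ⊆ G_{r'}` has `(X, Y, Z)`-marginals `(μ, ν, ρ)` then
`γ(P) ⊆ G_r ∩ C` (`r = 9s - 1`, open cone) has sum-marginal `λ`. [cite: FischerIkenmeyer2020, Lemma 8 (proof)] -/
theorem forward (hν : ν.length = μ.length) (hρ : ρ.length = μ.length)
    (h : (μ, ν, ρ) ∈ twoDXRaySet) :
    ∃ R : ℕ, (lam μ ν ρ).length = R + 1 ∧ ∃ Q : Finset Point,
      (∀ q ∈ Q, IsInOpenCone q ∧ coordSum q = R) ∧ sumMarginal Q = listFn (lam μ ν ρ) := by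
  obtain ⟨r, hμr, -, -, P, hP, hX, hY, hZ⟩ := h
  change μ.length = r + 1 at hμr
  change xMarginal P = listFn μ at hX
  change yMarginal P = listFn ν at hY
  change zMarginal P = listFn ρ at hZ
  refine ⟨9 * μ.length - 1, by rw [length_lam hν hρ]; omega, P.image (shift μ.length), ?_, ?_⟩
  · intro q hq
    obtain ⟨p, hp, rfl⟩ := Finset.mem_image.1 hq
    have := hP p hp
    simp only [IsInOpenCone, coordSum, shift] at this ⊢
    omega
  · funext i
    have inj := (shift_injective μ.length).injOn (s := (P : Set Point))
    have hx : xMarginal (P.image (shift μ.length)) i =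
        if 6 * μ.length ≤ i then listFn μ (i - 6 * μ.length) else 0 := by
      rw [xMarginal_image inj]
      simp only [shift]
      split_ifs with h6
      · rw [← hX]
        unfold xMarginal
        congr 1
        exact Finset.filter_congr fun p _ => by omega
      · exact Finset.card_eq_zero.2 (Finset.filter_eq_empty_iff.2 fun p _ h => by omega)
    have hy : yMarginal (P.image (shift μ.length)) i =
        if 2 * μ.length ≤ i then listFn ν (i - 2 * μ.length) else 0 := by
      rw [yMarginal_image inj]
      simp only [shift]
      split_ifs with h2
      · rw [← hY]
        unfold yMarginal
        congr 1
        exact Finset.filter_congr fun p _ => by omega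
      · exact Finset.card_eq_zero.2 (Finset.filter_eq_empty_iff.2 fun p _ h => by omega)
    have hz : zMarginal (P.image (shift μ.length)) i = listFn ρ i := by
      rw [zMarginal_image inj, ← hZ]
      rfl
    rw [sumMarginal, hx, hy, hz, listFn_lam hν hρ]
    ring

/-! ### `γ` is onto: every solution point of the symmetric instance lies in `M × N × R` -/

/-- **The case analysis of the printed proof**: a point of a set `P ⊆ G_r ∩ C̄` with sum-marginal
`λ` has all three coordinates in `M ∪ N ∪ R` (their marginals are positive), and "two coordinates in
`R`", "two in `N`", "two in `M`" each contradict `x + y + z = r`; with `x ≥ y ≥ z` this places the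
point in `M × N × R`. [cite: FischerIkenmeyer2020, Lemma 8 (proof)] -/
theorem box_of_solution (hν : ν.length = μ.length) (hρ : ρ.length = μ.length) {R : ℕ}
    (hR : (lam μ ν ρ).length = R + 1) {Q : Finset Point}
    (hQ : ∀ q ∈ Q, IsInClosedCone q ∧ coordSum q = R) (hS : sumMarginal Q = listFn (lam μ ν ρ))
    {q : Point} (hq : q ∈ Q) :
    6 * μ.length ≤ q.1 ∧ q.1 < 7 * μ.length ∧ 2 * μ.length ≤ q.2.1 ∧ q.2.1 < 3 * μ.length ∧
      q.2.2 < μ.length := by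
  have h9 : 9 * μ.length = R + 1 := by rw [← length_lam hν hρ, hR]
  have c1 := cases_of_listFn_lam_ne_zero hν hρ (by rw [← hS]; exact (sumMarginal_pos_of_fst hq).ne')
  have c2 := cases_of_listFn_lam_ne_zero hν hρ (by rw [← hS]; exact (sumMarginal_pos_of_snd hq).ne')
  have c3 := cases_of_listFn_lam_ne_zero hν hρ (by rw [← hS]; exact (sumMarginal_pos_of_thd hq).ne')
  obtain ⟨⟨hxy, hyz⟩, hsum⟩ := hQ q hq
  simp only [coordSum] at hsum
  omega

/-- **Surjectivity of `γ`**: a set `Q ⊆ G_r ∩ C̄` with sum-marginal `λ` is `γ(P)` for the point set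
`P = {(x - 6s, y - 2s, z)} ⊆ G_{r'}`, which has `(X, Y, Z)`-marginals `(μ, ν, ρ)`; in particular the
2D-X-RAY instance is a yes-instance. [cite: FischerIkenmeyer2020, Lemma 8 (proof)] -/
theorem backward (hν : ν.length = μ.length) (hρ : ρ.length = μ.length) {R : ℕ}
    (hR : (lam μ ν ρ).length = R + 1) {Q : Finset Point}
    (hQ : ∀ q ∈ Q, IsInClosedCone q ∧ coordSum q = R) (hS : sumMarginal Q = listFn (lam μ ν ρ)) :
    (μ, ν, ρ) ∈ twoDXRaySet := by
  have h9 : 9 * μ.length = R + 1 := by rw [← length_lam hν hρ, hR]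
  have box := fun q (hq : q ∈ Q) => box_of_solution hν hρ hR hQ hS hq
  have hinj : Set.InjOn (unshift μ.length) Q := by
    rintro ⟨x, y, z⟩ hq ⟨x', y', z'⟩ hq' h
    have b := box _ hq
    have b' := box _ hq'
    simp only [unshift, Prod.mk.injEq] at h b b' ⊢
    omega
  refine ⟨μ.length - 1, ?_, ?_, ?_, Q.image (unshift μ.length), ?_, ?_, ?_, ?_⟩
  · change μ.length = _; omega
  · change ν.length = _; omega
  · change ρ.length = _; omega
  · intro p hp
    obtain ⟨q, hq, rfl⟩ := Finset.mem_image.1 hp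
    have b := box q hq
    obtain ⟨-, hsum⟩ := hQ q hq
    simp only [coordSum, unshift] at hsum b ⊢
    omega
  · change xMarginal _ = listFn μ
    funext i
    rw [xMarginal_image hinj]
    simp only [unshift]
    by_cases hi : i < μ.length
    · have e1 : (Q.filter fun q => q.1 - 6 * μ.length = i).card = xMarginal Q (i + 6 * μ.length) := by
        unfold xMarginal
        congr 1
        exact Finset.filter_congr fun q hq => by have := box q hq; omega
      have e2 : yMarginal Q (i + 6 * μ.length) = 0 :=
        yMarginal_eq_zero fun q hq => by have := box q hq; omega
      have e3 : zMarginal Q (i + 6 * μ.length) = 0 :=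
        zMarginal_eq_zero fun q hq => by have := box q hq; omega
      have e4 := congrFun hS (i + 6 * μ.length)
      simp only [sumMarginal, e2, e3, Nat.add_zero] at e4
      rw [listFn_lam hν hρ, if_pos (by omega), if_pos (by omega), listFn_of_le (l := ρ) (by omega),
        listFn_of_le (l := ν) (by omega), show i + 6 * μ.length - 6 * μ.length = i by omega] at e4
      rw [e1, e4]
      simp
    · rw [listFn_of_le (not_lt.1 hi)]
      exact Finset.card_eq_zero.2 (Finset.filter_eq_empty_iff.2 fun q hq h => by
        have := box q hq; omega)
  · change yMarginal _ = listFn ν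
    funext i
    rw [yMarginal_image hinj]
    simp only [unshift]
    by_cases hi : i < μ.length
    · have e1 : (Q.filter fun q => q.2.1 - 2 * μ.length = i).card = yMarginal Q (i + 2 * μ.length) := by
        unfold yMarginal
        congr 1
        exact Finset.filter_congr fun q hq => by have := box q hq; omega
      have e2 : xMarginal Q (i + 2 * μ.length) = 0 :=
        xMarginal_eq_zero fun q hq => by have := box q hq; omega
      have e3 : zMarginal Q (i + 2 * μ.length) = 0 :=
        zMarginal_eq_zero fun q hq => by have := box q hq; omega
      have e4 := congrFun hS (i + 2 * μ.length)
      simp only [sumMarginal, e2, e3, Nat.zero_add, Nat.add_zero] at e4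
      rw [listFn_lam hν hρ, if_pos (by omega), if_neg (by omega), listFn_of_le (l := ρ) (by omega),
        show i + 2 * μ.length - 2 * μ.length = i by omega] at e4
      rw [e1, e4]
      simp
    · rw [listFn_of_le (show ν.length ≤ i by omega)]
      exact Finset.card_eq_zero.2 (Finset.filter_eq_empty_iff.2 fun q hq h => by
        have := box q hq; omega)
  · change zMarginal _ = listFn ρ
    funext i
    rw [zMarginal_image hinj]
    simp only [unshift]
    by_cases hi : i < μ.length
    · have e1 : (Q.filter fun q => q.2.2 = i).card = zMarginal Q i := rfl
      have e2 : xMarginal Q i = 0 := xMarginal_eq_zero fun q hq => by have := box q hq; omega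
      have e3 : yMarginal Q i = 0 := yMarginal_eq_zero fun q hq => by have := box q hq; omega
      have e4 := congrFun hS i
      simp only [sumMarginal, e2, e3, Nat.zero_add] at e4
      rw [listFn_lam hν hρ, if_neg (by omega), if_neg (by omega), Nat.add_zero] at e4
      rw [e1, e4]
    · rw [listFn_of_le (show ρ.length ≤ i by omega)]
      exact Finset.card_eq_zero.2 (Finset.filter_eq_empty_iff.2 fun q hq h => by
        have := box q hq; omega)

/-! ### Lemma 8 at the level of instances -/

/-- **Lemma 8, SYMMETRIC target** (decision form, instances): for fields of a common length,
`(μ, ν, ρ)` is a yes-instance of 2D-X-RAY iff `λ` is a yes-instance of SYMMETRIC-2D-X-RAY.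
[cite: FischerIkenmeyer2020, Lemma 8] -/
theorem mem_twoDXRaySet_iff_sym (hν : ν.length = μ.length) (hρ : ρ.length = μ.length) :
    (μ, ν, ρ) ∈ twoDXRaySet ↔ lam μ ν ρ ∈ symTwoDXRaySet := by
  constructor
  · intro h
    obtain ⟨R, hR, Q, hQ, hS⟩ := forward hν hρ h
    exact ⟨R, hR, Q, fun q hq => ⟨⟨(hQ q hq).1.1.le, (hQ q hq).1.2.le⟩, (hQ q hq).2⟩, hS⟩
  · rintro ⟨R, hR, Q, hQ, hS⟩
    exact backward hν hρ hR hQ hS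

/-- **Lemma 8, SKEW-SYMMETRIC target** (decision form, instances): for fields of a common length,
`(μ, ν, ρ)` is a yes-instance of 2D-X-RAY iff `λ` is a yes-instance of SKEW-SYMMETRIC-2D-X-RAY
("without any changes the whole proof also works for the open cone"). [cite: FischerIkenmeyer2020, Lemma 8] -/
theorem mem_twoDXRaySet_iff_skewSym (hν : ν.length = μ.length) (hρ : ρ.length = μ.length) :
    (μ, ν, ρ) ∈ twoDXRaySet ↔ lam μ ν ρ ∈ skewSymTwoDXRaySet := by
  constructor
  · intro h
    obtain ⟨R, hR, Q, hQ, hS⟩ := forward hν hρ h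
    exact ⟨R, hR, Q, hQ, hS⟩
  · rintro ⟨R, hR, Q, hQ, hS⟩
    exact backward hν hρ hR (fun q hq => ⟨⟨(hQ q hq).1.1.le, (hQ q hq).1.2.le⟩, (hQ q hq).2⟩) hS

end Symmetrization

end Tomography

end Literature.Computability.Complexity
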